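import Literature.GroupTheory.ArithmeticGroups.SL2PrimePowCentralExtensionLayer
import Literature.GroupTheory.ArithmeticGroups.SL2PrimePowDescentLinearOdd
import HarnessLib

/-!
# Central extensions of `SL₂(ℤ/p^e)`, odd `p`: the twisted descent relations

Torus-free companion of `SL2PrimePowCentralExtensionLayer.descent_relations`.  For `p ≥ 5` the torus
`diag(2,2⁻¹)` kills the `T̄`-cocycle constant `z'` of the top layer; for `p = 3` there is no torus, but the
constant can be ABSORBED: with a central `w`, `w⁻² = z'`, the twisted triple `e₀w, h₁w, f₀w⁻¹` satisfies the
constant-free conjugation table (`descent_relations_twisted`).  This is the input of the descent proving that the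
`p`-primary part of the Schur multiplier of `SL₂(ℤ/p^e)` vanishes for every ODD prime `p` [Beyl1986]
(sequel `SL2PrimePowSchurMultiplierOdd`).  Hypothesis form, no definitions.
-/

open scoped MatrixGroups
open Matrix Matrix.SpecialLinearGroup

namespace Literature.GroupTheory.ArithmeticGroups

namespace SL2CentralExtensionOdd

open Literature.GroupTheory.ArithmeticGroups.SL2CentralExtension
variable {p e : ℕ} {E : Type*} [Group E] {π : E →* SL(2, ZMod (p ^ e))}
variable (hcen : ∀ z : E, π z = 1 → ∀ g : E, g * z = z * g) (hexp : ∀ z : E, π z = 1 → z ^ p = 1)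
variable {t l e₀ f₀ h₁ : E} (he₀ : e₀ = t ^ p ^ (e - 1)) (hf₀ : f₀ = l ^ p ^ (e - 1))
  (hh₁ : h₁ = t * f₀ * t⁻¹ * f₀⁻¹ * e₀)
  (ht : ((π t : SL(2, ZMod (p ^ e))) : Matrix (Fin 2) (Fin 2) (ZMod (p ^ e))) = !![1, 1; 0, 1])
  (hl : ((π l : SL(2, ZMod (p ^ e))) : Matrix (Fin 2) (Fin 2) (ZMod (p ^ e))) = !![1, 0; 1, 1])

include hcen hexp he₀ hf₀ hh₁ ht hl in
open scoped IsMulCommutative in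
/-- **Descent relations, twisted form (every odd prime `p`, `e ≥ 2`).** In a central extension `π : E →
SL₂(ℤ/p^e)` with central kernel of exponent `p`, let `t, l` lie over `T̄, L̄`, `e₀ = t^{p^{e-1}}`, `f₀ =
l^{p^{e-1}}`, `h₁ = t f₀ t⁻¹ f₀⁻¹ e₀`, and let `w` be a kernel element with `t h₁ t⁻¹ = h₁ e₀⁻² w⁻²` (a square
root of the inverse `T̄`-cocycle constant; it exists as the kernel has odd exponent).  Then the TWISTED
generators `e' = e₀ w`, `h' = h₁ w`, `f' = f₀ w⁻¹` have order `p` and are conjugated by `t^{±1}`, `l^{±1}`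
EXACTLY by the `𝔰𝔩₂`-table (no kernel constants).  Proof: transport to the additive layer
(`SL2CentralExtension.comm_of_layer`), `SL2DescentLinear.torsion`/`l_e`, `SL2DescentLinearOdd.lconst_eq_tconst`,
and `abel` for the twisted triple.  No torus is used, so `p = 3` is allowed. [cite: Beyl1986, Theorem
(M(SL(2,ℤ/m)) = 0 for 4 ∤ m), p-primary part] -/
theorem descent_relations_twisted [Fact p.Prime] (hp2 : p ≠ 2) (he : 2 ≤ e) {w e' h' f' : E}
    (hw1 : π w = 1) (htw : t * h₁ * t⁻¹ = h₁ * e₀⁻¹ * e₀⁻¹ * w⁻¹ * w⁻¹)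
    (he' : e' = e₀ * w) (hh' : h' = h₁ * w) (hf' : f' = f₀ * w⁻¹) :
    (e' ^ p = 1 ∧ h' ^ p = 1 ∧ f' ^ p = 1) ∧
    (t * e' * t⁻¹ = e' ∧ t * f' * t⁻¹ = h' * e'⁻¹ * f' ∧ l * f' * l⁻¹ = f') ∧
    t * h' * t⁻¹ = h' * e'⁻¹ * e'⁻¹ ∧ l * e' * l⁻¹ = e' * h'⁻¹ * f'⁻¹ ∧ l * h' * l⁻¹ = h' * f' * f' ∧
    (t⁻¹ * h' * t = h' * e' * e' ∧ t⁻¹ * f' * t = f' * h'⁻¹ * e'⁻¹) ∧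
    (l⁻¹ * h' * l = h' * f'⁻¹ * f'⁻¹ ∧ l⁻¹ * e' * l = e' * h' * f'⁻¹) := by
  have hp : p.Prime := Fact.out
  have hϖ := SL2TopLayer.varpi_mul_varpi p e he
  have hpϖ := SL2TopLayer.natCast_mul_varpi p e (by omega : 1 ≤ e)
  have hE := coe_map_e₀' he₀ ht
  have hF := coe_map_f₀' hf₀ hl
  have hH := coe_map_h₁' he₀ hf₀ hh₁ ht hl he
  -- the layer preimage
  set A : Subgroup E := ((Matrix.SpecialLinearGroup.map
    (ZMod.castHom (pow_dvd_pow p (Nat.sub_le e 1)) (ZMod (p ^ (e - 1))))).comp π).ker with hAdef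
  have memA : ∀ x : E, x ∈ A ↔ Matrix.SpecialLinearGroup.map
      (ZMod.castHom (pow_dvd_pow p (Nat.sub_le e 1)) (ZMod (p ^ (e - 1)))) (π x) = 1 := fun x ↦ by
    rw [hAdef, MonoidHom.mem_ker, MonoidHom.comp_apply]
  haveI : A.Normal := by rw [hAdef]; infer_instance
  have hA : ∀ x ∈ A, ∀ y ∈ A, x * y = y * x := fun x hx y hy ↦
    comm_of_layer hcen hexp he₀ hf₀ hh₁ ht hl he hp2 ((memA x).mp hx) ((memA y).mp hy)
  haveI : IsMulCommutative A := ⟨⟨fun a b ↦ Subtype.ext (hA _ a.2 _ b.2)⟩⟩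
  have heA : e₀ ∈ A := (memA _).mpr (layer_e₀ he₀ ht)
  have hfA : f₀ ∈ A := (memA _).mpr (layer_f₀ hf₀ hl)
  have hhA : h₁ ∈ A := (memA _).mpr (layer_h₁ he₀ hf₀ hh₁ ht hl he)
  have hzA : ∀ z : E, π z = 1 → z ∈ A := fun z hz ↦ (memA _).mpr (by rw [hz, map_one])
  -- additive model
  let ψ : E → (Additive A ≃+ Additive A) := fun g ↦ MulEquiv.toAdditive (MulAut.conjNormal g)
  have hψ : ∀ (g : E) (a : A), ((Additive.toMul (ψ g (Additive.ofMul a)) : A) : E) = g * a * g⁻¹ :=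
    fun g a ↦ MulAut.conjNormal_apply g a
  have hcomp : ∀ (g g' : E) (v : Additive A), ψ (g * g') v = ψ g (ψ g' v) := by
    intro g g' v
    show MulEquiv.toAdditive (MulAut.conjNormal (g * g')) v = _
    rw [map_mul]; rfl
  have hsymm : ∀ (g : E) (v : Additive A), (ψ g).symm v = ψ g⁻¹ v := by
    intro g v
    show (MulEquiv.toAdditive (MulAut.conjNormal g)).symm v = MulEquiv.toAdditive (MulAut.conjNormal g⁻¹) v
    rw [map_inv]; rfl
  let eV : Additive A := Additive.ofMul ⟨e₀, heA⟩
  let hV : Additive A := Additive.ofMul ⟨h₁, hhA⟩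
  let fV : Additive A := Additive.ofMul ⟨f₀, hfA⟩
  let Z : AddSubgroup (Additive A) := (Subgroup.toAddSubgroup ((π.comp A.subtype).ker))
  have memZ : ∀ v : Additive A, v ∈ Z ↔ π ((Additive.toMul v : A) : E) = 1 := fun v ↦ by
    show Additive.toMul v ∈ (π.comp A.subtype).ker ↔ _
    rw [MonoidHom.mem_ker, MonoidHom.comp_apply, Subgroup.coe_subtype]
  -- a criterion for equalities in the additive model
  have crit : ∀ (v w : Additive A), ((Additive.toMul v : A) : E) = ((Additive.toMul w : A) : E) → v = w :=
    fun v w h ↦ Additive.toMul.injective (Subtype.ext h)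
  have coe_e : ((Additive.toMul eV : A) : E) = e₀ := rfl
  have coe_h : ((Additive.toMul hV : A) : E) = h₁ := rfl
  have coe_f : ((Additive.toMul fV : A) : E) = f₀ := rfl
  -- (Z) facts
  have pZ : ∀ v ∈ Z, p • v = 0 := fun v hv ↦ crit _ _ (by
    rw [toMul_nsmul, Subgroup.coe_pow, toMul_zero, Subgroup.coe_one]; exact hexp _ ((memZ v).mp hv))
  have fixall : ∀ (g : E), π g = 1 → ∀ v : Additive A, ψ g v = v := fun g hg v ↦ crit _ _ (by
    rw [show v = Additive.ofMul (Additive.toMul v) from rfl, hψ]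
    rw [toMul_ofMul, ← hcen g hg, mul_inv_cancel_right])
  have fixg : ∀ (g : E), ∀ v ∈ Z, ψ g v = v := fun g v hv ↦ crit _ _ (by
    rw [show v = Additive.ofMul (Additive.toMul v) from rfl, hψ, toMul_ofMul,
      hcen _ ((memZ v).mp hv) g, mul_inv_cancel_right])
  -- p-th powers are central
  have pe : p • eV ∈ Z := (memZ _).mpr (by
    rw [toMul_nsmul, Subgroup.coe_pow, coe_e, map_pow]; exact SL2TopLayer.eBar_pow_p _ p hpϖ _ hE)
  have pf : p • fV ∈ Z := (memZ _).mpr (by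
    rw [toMul_nsmul, Subgroup.coe_pow, coe_f, map_pow]; exact SL2TopLayer.fBar_pow_p _ p hpϖ _ hF)
  have ph : p • hV ∈ Z := (memZ _).mpr (by
    rw [toMul_nsmul, Subgroup.coe_pow, coe_h, map_pow]; exact SL2TopLayer.hBar_pow_p _ p hϖ hpϖ _ hH)
  -- t-relations
  have te : ψ t eV = eV := crit _ _ (by rw [hψ]; change t * e₀ * t⁻¹ = e₀; rw [he₀]; group)
  have tf : ψ t fV = hV - eV + fV := crit _ _ (by
    rw [hψ, toMul_add, toMul_sub, Subgroup.coe_mul, Subgroup.coe_div, coe_e, coe_h, coe_f]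
    change t * f₀ * t⁻¹ = _
    rw [hh₁]; simp only [div_eq_mul_inv]; group)
  -- the element s = t⁻¹ l t⁻¹
  set sE : E := t⁻¹ * l * t⁻¹ with hsE
  have hst : π (sE * t * sE⁻¹) = π l⁻¹ := by
    simp only [hsE, map_mul, map_inv]
    exact SL2TopLayer.sBar_conj_tBar (π t) (π l) ht hl
  have hsl : π (sE * l * sE⁻¹) = π t⁻¹ := by
    simp only [hsE, map_mul, map_inv]
    exact SL2TopLayer.sBar_conj_lBar (π t) (π l) ht hl
  obtain ⟨ζt, hζt, hstζ⟩ := exists_eq_mul_of_map_eq hst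
  obtain ⟨ζl, hζl, hslζ⟩ := exists_eq_mul_of_map_eq hsl
  have se : ψ sE eV = -fV := crit _ _ (by
    rw [hψ, toMul_neg, Subgroup.coe_inv, coe_f]
    change sE * e₀ * sE⁻¹ = f₀⁻¹
    rw [he₀, hf₀, conj_pow_eq hcen hexp he hζt hstζ, inv_pow])
  have sf : ψ sE fV = -eV := crit _ _ (by
    rw [hψ, toMul_neg, Subgroup.coe_inv, coe_e]
    change sE * f₀ * sE⁻¹ = e₀⁻¹
    rw [he₀, hf₀, conj_pow_eq hcen hexp he hζl hslζ, inv_pow])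
  have hs : ∀ v, ψ sE v = (ψ t).symm (ψ l ((ψ t).symm v)) := fun v ↦ by
    simp only [hsymm]
    rw [← hcomp, ← hcomp, hsE, mul_assoc]
  have hl' : ∀ v, ψ l v = ψ t (ψ sE (ψ t v)) := fun v ↦ by
    rw [← hcomp, ← hcomp, hsE]
    congr 2; group
  -- l-relations
  have lf : ψ l fV = fV := crit _ _ (by rw [hψ]; change l * f₀ * l⁻¹ = f₀; rw [hf₀]; group)
  have lh : ψ l hV - (hV + 2 • fV) ∈ Z := (memZ _).mpr (by
    rw [toMul_sub, toMul_add, toMul_nsmul, Subgroup.coe_div, Subgroup.coe_mul, Subgroup.coe_pow, hψ,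
      coe_f, coe_h]
    change π (l * h₁ * l⁻¹ / (h₁ * f₀ ^ 2)) = 1
    rw [map_div, map_mul, map_mul, map_mul, map_inv, map_pow,
      SL2TopLayer.lBar_conj_hBar _ (π l) (π f₀) (π h₁) hϖ hl hF hH]
    simp only [div_eq_mul_inv]; group)
  -- the constant w
  have hwA : w ∈ A := hzA w hw1
  let wV : Additive A := Additive.ofMul ⟨w, hwA⟩
  have coe_w : ((Additive.toMul wV : A) : E) = w := rfl
  have hwZ : wV ∈ Z := (memZ _).mpr (by rw [coe_w]; exact hw1)
  set zV : Additive A := -(2 • wV) with hzVdef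
  have hzZ : zV ∈ Z := Z.neg_mem (Z.nsmul_mem hwZ 2)
  have th_eq : ψ t hV = hV - 2 • eV + zV := crit _ _ (by
    rw [hψ, toMul_add, toMul_sub, toMul_nsmul, hzVdef, toMul_neg, toMul_nsmul, Subgroup.coe_mul,
      Subgroup.coe_div, Subgroup.coe_pow, Subgroup.coe_inv, Subgroup.coe_pow, coe_e, coe_h, coe_w]
    change t * h₁ * t⁻¹ = _
    rw [htw]; simp only [div_eq_mul_inv, sq, _root_.mul_inv_rev, mul_assoc])
  have th : ψ t hV - (hV - 2 • eV) ∈ Z := by rw [th_eq]; convert hzZ using 1; abel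
  -- apply the additive core
  have le := SL2DescentLinear.l_e (ψ t) (ψ l) (ψ sE) eV hV fV te tf se hl'
  obtain ⟨pe0, ph0, pf0⟩ := SL2DescentLinear.torsion hp hp2 (ψ t) (ψ l) eV hV fV Z pZ (fixg t) (fixg l)
    pe ph pf tf th le
  set z'' := ψ l hV - (hV + 2 • fV) with hz''def
  have lh_eq : ψ l hV = hV + 2 • fV + z'' := by rw [hz''def]; abel
  have hzz : z'' = zV := SL2DescentLinearOdd.lconst_eq_tconst (ψ t) (ψ l) (ψ sE) eV hV fV zV z'' te tf th_eq
    (fixg t _ hzZ) lf le lh_eq (fixg l _ hzZ) sf hs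
  rw [hzz] at lh_eq
  obtain ⟨tse, tsh, tsf⟩ := SL2DescentLinearOdd.t_symm_z (ψ t) eV hV fV zV te tf th_eq (fixg t _ hzZ)
  obtain ⟨lsf, lsh, lse⟩ := SL2DescentLinearOdd.l_symm_z (ψ l) eV hV fV zV lf le lh_eq (fixg l _ hzZ)
  -- primed vectors
  have hwfix : ∀ g : E, ψ g wV = wV := fun g ↦ fixg g _ hwZ
  set eP : Additive A := eV + wV with hePdef
  set hP : Additive A := hV + wV with hhPdef
  set fP : Additive A := fV - wV with hfPdef
  have coe_eP : ((Additive.toMul eP : A) : E) = e' := by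
    rw [he', hePdef, toMul_add, Subgroup.coe_mul, coe_e, coe_w]
  have coe_hP : ((Additive.toMul hP : A) : E) = h' := by
    rw [hh', hhPdef, toMul_add, Subgroup.coe_mul, coe_h, coe_w]
  have coe_fP : ((Additive.toMul fP : A) : E) = f' := by
    rw [hf', hfPdef, toMul_sub, Subgroup.coe_div, coe_f, coe_w, div_eq_mul_inv]
  have P_te : ψ t eP = eP := by rw [hePdef, map_add, te, hwfix]
  have P_tf : ψ t fP = hP - eP + fP := by
    rw [hfPdef, hhPdef, hePdef, map_sub, tf, hwfix]; abel
  have P_th : ψ t hP = hP - 2 • eP := by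
    rw [hhPdef, hePdef, map_add, th_eq, hwfix, hzVdef]; abel
  have P_lf : ψ l fP = fP := by rw [hfPdef, map_sub, lf, hwfix]
  have P_le : ψ l eP = eP - hP - fP := by
    rw [hePdef, hhPdef, hfPdef, map_add, le, hwfix]; abel
  have P_lh : ψ l hP = hP + 2 • fP := by
    rw [hhPdef, hfPdef, map_add, lh_eq, hwfix, hzVdef]; abel
  obtain ⟨P_tse, P_tsh, P_tsf⟩ := SL2DescentLinear.t_symm (ψ t) eP hP fP P_te P_tf P_th
  obtain ⟨P_lsf, P_lsh, P_lse⟩ := SL2DescentLinear.l_symm (ψ l) eP hP fP P_lf P_le P_lh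
  -- orders
  have P_pe : p • eP = 0 := by rw [hePdef, smul_add, pe0, pZ _ hwZ, add_zero]
  have P_ph : p • hP = 0 := by rw [hhPdef, smul_add, ph0, pZ _ hwZ, add_zero]
  have P_pf : p • fP = 0 := by rw [hfPdef, smul_sub, pf0, pZ _ hwZ, sub_zero]
  clear_value eP hP fP
  -- translate back
  have back : ∀ {v v' : Additive A}, v = v' → ((Additive.toMul v : A) : E) = ((Additive.toMul v' : A) : E) :=
    fun h ↦ by rw [h]
  have hψ' : ∀ (g : E) (v : Additive A), ((Additive.toMul (ψ g v) : A) : E) =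
      g * ((Additive.toMul v : A) : E) * g⁻¹ := fun g v ↦ hψ g (Additive.toMul v)
  refine ⟨⟨?_, ?_, ?_⟩, ⟨?_, ?_, ?_⟩, ?_, ?_, ?_, ⟨?_, ?_⟩, ⟨?_, ?_⟩⟩
  · have := back P_pe
    rwa [toMul_nsmul, Subgroup.coe_pow, coe_eP, toMul_zero, Subgroup.coe_one] at this
  · have := back P_ph
    rwa [toMul_nsmul, Subgroup.coe_pow, coe_hP, toMul_zero, Subgroup.coe_one] at this
  · have := back P_pf
    rwa [toMul_nsmul, Subgroup.coe_pow, coe_fP, toMul_zero, Subgroup.coe_one] at this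
  · have := back P_te
    rwa [hψ', coe_eP] at this
  · have := back P_tf
    rw [hψ', toMul_add, toMul_sub, Subgroup.coe_mul, Subgroup.coe_div, coe_fP, coe_hP, coe_eP] at this
    rw [this]; simp only [div_eq_mul_inv]
  · have := back P_lf
    rwa [hψ', coe_fP] at this
  · have := back P_th
    rw [hψ', toMul_sub, toMul_nsmul, Subgroup.coe_div, Subgroup.coe_pow, coe_hP, coe_eP] at this
    rw [this]; simp only [div_eq_mul_inv]; group
  · have := back P_le
    rw [hψ', toMul_sub, toMul_sub, Subgroup.coe_div, Subgroup.coe_div, coe_hP, coe_eP, coe_fP] at this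
    rw [this]; simp only [div_eq_mul_inv]
  · have := back P_lh
    rw [hψ', toMul_add, toMul_nsmul, Subgroup.coe_mul, Subgroup.coe_pow, coe_hP, coe_fP] at this
    rw [this, sq, ← mul_assoc]
  · have := back P_tsh
    rw [hsymm, hψ', toMul_add, toMul_nsmul, Subgroup.coe_mul, Subgroup.coe_pow, coe_hP, coe_eP] at this
    rw [inv_inv] at this
    rw [this, sq, ← mul_assoc]
  · have := back P_tsf
    rw [hsymm, hψ', toMul_sub, toMul_sub, Subgroup.coe_div, Subgroup.coe_div, coe_hP, coe_eP, coe_fP] at this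
    rw [inv_inv] at this
    rw [this]; simp only [div_eq_mul_inv]
  · have := back P_lsh
    rw [hsymm, hψ', toMul_sub, toMul_nsmul, Subgroup.coe_div, Subgroup.coe_pow, coe_hP, coe_fP] at this
    rw [inv_inv] at this
    rw [this]; simp only [div_eq_mul_inv]; group
  · have := back P_lse
    rw [hsymm, hψ', toMul_sub, toMul_add, Subgroup.coe_div, Subgroup.coe_mul, coe_hP, coe_eP, coe_fP] at this
    rw [inv_inv] at this
    rw [this]; simp only [div_eq_mul_inv]

end SL2CentralExtensionOdd

end Literature.GroupTheory.ArithmeticGroups
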